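import Literature.MathematicalPhysics.QuantumFieldTheory.Balaban1983to89.B1Ineq367SmallField

/-!
# `Balaban1983to89.B1Ineq352LevelK` — T. Bałaban, *(Higgs)₂,₃ quantum fields in a finite volume. I. A lower bound*,
Commun. Math. Phys. **85** (1982) 603–626 [Balaban1982Higgs1]: the mechanism of **(3.52)** p. 621 — *"the restrictions introduced by χ_{k+1}(ψ)
or χ_k(φ) imply some restrictions on the fields ψ, φ"* — AT THE LAST LEVEL `k = K` FOR THE CONCRETE (Higgs)₂,₃ MODEL, both fields,
HYPOTHESIS-FREE: on the support of the cut-off `χ_K(A)χ_K(φ)` ((3.27)–(3.28), `B1Ineq326HiggsModel.chiW`) the level-`K` fields themselves are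
bounded, `|φ(y)|, |A(y)| ≦ c·(L^Kε)^{−(d−2)/2}p_K` with `c = a_K⁻¹(1 + m²(L^Kε)²) + 1` (resp. `μ₀²`), hence with a `K, ε`-free `c` under
`L^Kε ≦ 1` — this is *"the restrictions on the fields A, φ"* used on p. 625 to bound the interaction `V^{(K),ε}`

statement-level skeleton of published theorems with citation tags; proofs where landed; nothing here is a claim about the Yang–Mills mass gap

PDF held: `paper:balaban1982-cmp85-higgs23-i` (journal page = PDF page + 602); p. 621 [PDF 19] ((3.52)), p. 617 [PDF 15] ((3.27)–(3.29)),
p. 610 [PDF 8] ((2.20)), p. 625 [PDF 23] READ AS IMAGES on the ×2 renders `run/shared/lean/pub/pub-balaban/b2b-balaban-ref1/pages/1982-cmp85-higgs23-I/…`.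

CITATION HEADER (lean-in-tree rule).  Cell `lit-balaban` (HOME `run/shared/lean/pub/lit-balaban/`), Phase-2 proof seat **p14** gen 12 (unit
`lit-balaban-p14`; TAKING line HOME/STATUS.md 2026-08-21T22:39Z), file 2 of 3.  SKELETON rows **B1.Eq3.52** (owner r12; the carrier-abstract
(3.52) is this seat's `B1Ineq352Proof`, gen 2 — over abstract `Qs, G, P` with the isometry / inverse / averaging HYPOTHESES; HERE those three
hypotheses are the tree's THEOREMS about the concrete operators: `B2Prop22Proof.norm_avgQkAdj_apply` (`|(Q_K^*φ)(x)| = |φ(x_K)|`),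
`HiggsCovariancePos.covOpK_propagatorK_apply` (`(G^ε_K)⁻¹G^ε_K = 1` with the printed `(G^ε_K)⁻¹ = −Δ^ε_A + m² + a_K(L^Kε)^{−2}P_K`, (2.20)),
`B1Eq353SupNorm.norm_projPk_apply_le` (`‖P_K‖_{∞→∞} ≦ 1`)), and **B1.Eq3.66–3.67** / **B1.Thm@606** (p. 625: the field bounds feeding the
estimate of `|V^{(K),ε}|`, input `hE2` of `B1Eq369Model.PreInputs369`; file 3 `B1Prop32InteractionBound` uses this file).  USED BY NAME, never
restated: the three theorems above, `B1Eq31Concrete.{chiKA, chiKφ, chi0A, chi0φ, chiSmall, chiProd_eq_ite, thrF, thrLap, bgVec, bgScalar, toSite_bgVec,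
negLap}`, `B1Eq353SupNorm.{thrLap_eq_inv_sq_mul_thrF, card_blockK}`, `B1LowerBound.bgField`, `B1.{ainf_lt_aSeq, aSeq_pos}`.

WHAT IS PRINTED (verbatim, p. 621 [PDF 19]).  *"At first let us notice that the restrictions introduced by χ_{k+1}(ψ) or χ_k(φ) imply some
restrictions on the fields ψ, φ, for example we have: |ψ(y)| = |(Q*_{k+1}(B^{(k+1)})ψ)(x)| = a_{k+1}⁻¹L²|((−Δ^η_{B^{(k+1)}} + a_{k+1}L⁻²P_{k+1}(B^{(k+1)})
+ m²(L^kε)²)ψ^{(k+1)})(x)| ≦ a_{k+1}⁻¹L^{−(d−2)/2}p(L^{k+1}ε) + L^{−(d−2)/2}p(L^{k+1}ε) = cp(L^{k+1}ε) ≦ cp(L^kε) (3.52) for some c independent of k, ε."*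
(3.27)–(3.29) p. 617: `χ_k(A) = Π_xχ({|A^{(k),ε}(x)| ≦ (L^kε)^{−(d−2)/2}p(L^kε)})χ({|(Δ^εA^{(k),ε})(x)| ≦ (L^kε)^{−(d+2)/2}p(L^kε)})`, the same for
`φ^{(k),ε}` with `Δ^ε_{A^{(k),ε}}` (3.28); `A^{(k),ε} = a_k(L^kε)^{−2}G^ε_kQ_k^*A`, `φ^{(k),ε} = a_k(L^kε)^{−2}G^ε_k(A^{(k),ε})Q_k^*(A^{(k),ε})φ` (3.29).
p. 625 [PDF 23]: *"Using representation (3.57) in Proposition 3.2 and the restrictions on the fields A, φ we can estimate the absolute value of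
the interaction V^{(K)ε} by O(1)(L^Kε)^{κ₀}|T₁^{(K)}|."*

THE ARGUMENT AT LEVEL `K` (the print's, in `L^Kε`-lattice units).  Apply `(G^ε_K(Ã))⁻¹ = −Δ^ε_Ã + m² + a_Kℓ⁻²P_K(Ã)` (`ℓ = L^Kε`) to
`φ^{(K),ε} = a_Kℓ⁻²G^ε_K(Ã)Q_K^*(Ã)φ`: `a_Kℓ⁻²(Q_K^*φ)(x) = (−Δ^ε_Ãφ^{(K),ε})(x) + m²φ^{(K),ε}(x) + a_Kℓ⁻²(P_Kφ^{(K),ε})(x)`; with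
`|(Q_K^*φ)(x)| = |φ(x_K)|`, `‖P_K‖ ≦ 1` and the two restrictions of `χ_K(φ)`: `|φ(y)| ≦ a_K⁻¹ℓ²(ℓ^{−(d+2)/2}p + m²ℓ^{−(d−2)/2}p) + ℓ^{−(d−2)/2}p
= (a_K⁻¹(1 + m²ℓ²) + 1)·ℓ^{−(d−2)/2}p`.  The vector field: the same with `N = d`, trivial coupling, mass `μ₀²` (p. 608).

WHAT THIS FILE PROVES (theorems only — no `def`, no new `Prop`; kernel-checked, zero `sorry`; axioms standard).
* §1 `exists_blockIter_eq` (every `y ∈ T^{(K)}` is the `K`-block point of some `x ∈ T_ε`, `K ≦ K_P`), **`norm_le_of_bgField_bounds`** (the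
  (3.52) mechanism for the CONCRETE `G^ε_K(T_ε, Ã)`, `Q_K^*(Ã)`, any coupling/background/mass `> 0`: bounds `t₁`, `t₂` on `|φ^{bg}|`, `|Δ_Ãφ^{bg}|`
  give `|φ(y)| ≦ a_K⁻¹ℓ²(t₂ + m²t₁) + t₁`).
* §2 **`norm_le_of_chiKφ_ne_zero`** (`χ_K(φ) ≠ 0 ⇒ |φ(y)| ≦ (a_K⁻¹(1 + m²ℓ²) + 1)·ℓ^{−(d−2)/2}p`), **`norm_toSite_le_of_chiKA_ne_zero`** (the
  vector field), **`field_bounds_of_chiW_ne_zero`** (both, from `χ_K(A)χ_K(φ) ≠ 0`, `K ≧ 1`, thresholds `ℓ_K = L^Kε`, `p_K`).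
* §3 the `K, ε`-FREE constants *"for some c independent of k, ε"*: `fieldConst_le` (`a_K⁻¹(1 + m²ℓ²) + 1 ≦ (a(1−L⁻²))⁻¹(1 + m²) + 1` for `ℓ ≦ 1`,
  `K ≧ 1`, (2.15)), **`field_bounds_of_chiW_ne_zero_unif`**, and the unit-lattice reading `rpow_mul_thrF` (`ℓ^{(d−2)/2}·ℓ^{−(d−2)/2}p = p`),
  **`unit_field_bounds_of_chiW_ne_zero`** (`|ℓ^{(d−2)/2}φ_j(y)|, |ℓ^{(d−2)/2}A_μ(y)| ≦ c·p_K` componentwise — the bound on the arguments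
  `φ′`, `A′` of (3.57) used on p. 625).
HONEST SCOPE.  Nothing about (3.53) ff.; `m², μ₀² > 0` (p. 605), `a > 0`, `L > 1`, `1 ≦ K ≦` the `K` of (1.2).  Nothing here is summit progress.
-/

open scoped BigOperators

namespace Literature.MathematicalPhysics.QuantumFieldTheory.Balaban1983to89.B1Ineq352LevelK

open Literature.MathematicalPhysics.QuantumFieldTheory.Balaban1983to89.HiggsLattice (ChargeData)
open Literature.MathematicalPhysics.QuantumFieldTheory.Balaban1983to89.HiggsAveraging (blockIter blockK mem_blockK)
open Literature.MathematicalPhysics.QuantumFieldTheory.Balaban1983to89.HiggsCovariance (covLaplacianN avgQkAdj projPk covOpK propagatorK)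
open Literature.MathematicalPhysics.QuantumFieldTheory.Balaban1983to89.HiggsCovariancePos (covOpK_propagatorK_apply)
open Literature.MathematicalPhysics.QuantumFieldTheory.Balaban1983to89.B3MultiscaleFields (toSite zeroCharge)
open Literature.MathematicalPhysics.QuantumFieldTheory.Balaban1983to89.B1Eq31Concrete (chiSmall chiProd_eq_ite thrF thrLap chi0A chi0φ
  chiKA chiKφ bgVec bgScalar negLap toSite_bgVec)
open Literature.MathematicalPhysics.QuantumFieldTheory.Balaban1983to89.B1Ineq326HiggsModel (chiW)
open Literature.MathematicalPhysics.QuantumFieldTheory.Balaban1983to89.B1Eq353SupNorm (norm_projPk_apply_le thrLap_eq_inv_sq_mul_thrF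
  card_blockK)
open Literature.MathematicalPhysics.QuantumFieldTheory.Balaban1983to89.B2Prop22Proof (norm_avgQkAdj_apply)
open Literature.MathematicalPhysics.QuantumFieldTheory.Balaban1983to89.B1LowerBound (bgField)

variable {P : HiggsLattice.Params}

/-! ## §1 The (3.52) mechanism for the concrete operators of (2.20)/(3.29) -/

section Mechanism

variable {N : ℕ} (C : ChargeData N) (Abg : HiggsLattice.VecField P 0) {K : ℕ}

/-- Every site `y` of `T^{(K)}` is the `K`-block point `x_K` of some `x ∈ T_ε` (`K ≦` the `K` of (1.2): `|B^K(y)| = L^{Kd} ≧ 1`,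
`B1Eq353SupNorm.card_blockK`). [cite: Balaban1982Higgs1, (1.20) p.607] -/
theorem exists_blockIter_eq (hK : K ≤ P.K) (y : HiggsLattice.Site P K) : ∃ x : HiggsLattice.Site P 0, blockIter K x = y := by
  have hcard : 0 < (blockK K y).card := by
    rw [card_blockK hK y]
    exact pow_pos P.hL _
  obtain ⟨x, hx⟩ := Finset.card_pos.mp hcard
  exact ⟨x, (mem_blockK K y x).mp hx⟩

/-- **THE (3.52) MECHANISM, CONCRETE**: for the background map (3.29) `φ ↦ φ^{bg} = a_Kℓ⁻²G^ε_K(T_ε,Ã)Q_K^*(Ã)φ` (`ℓ = L^Kε`, any coupling,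
any background `Ã`, mass `m² > 0`, `a_K > 0`, `K ≦ K_P`), pointwise bounds `|φ^{bg}(x)| ≦ t₁`, `|(−Δ^ε_Ãφ^{bg})(x)| ≦ t₂` on `T_ε` give
`|φ(y)| ≦ a_K⁻¹ℓ²(t₂ + m²t₁) + t₁` on `T^{(K)}` — apply `(G^ε_K)⁻¹ = −Δ^ε_Ã + m² + a_Kℓ⁻²P_K` ((2.20)), `|(Q_K^*φ)(x)| = |φ(x_K)|`, `‖P_K‖ ≦ 1`.
[cite: Balaban1982Higgs1, (3.52) p.621; (2.20) p.610; (3.29) p.617] -/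
theorem norm_le_of_bgField_bounds {msq a : ℝ} (hmsq : 0 < msq) (hK : K ≤ P.K) (hak : 0 < B1.aSeq a P.L K)
    (φ : HiggsLattice.ScalarField P K N) {t₁ t₂ : ℝ}
    (h1 : ∀ x, ‖bgField (B1.aSeq a P.L K) (P.mesh K) (propagatorK C Finset.univ Abg msq a K) (avgQkAdj C Abg K) φ x‖ ≤ t₁)
    (h2 : ∀ x, ‖covLaplacianN C Finset.univ Abg
      (bgField (B1.aSeq a P.L K) (P.mesh K) (propagatorK C Finset.univ Abg msq a K) (avgQkAdj C Abg K) φ) x‖ ≤ t₂) :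
    ∀ y, ‖φ y‖ ≤ (B1.aSeq a P.L K)⁻¹ * P.mesh K ^ 2 * (t₂ + msq * t₁) + t₁ := by
  intro y
  obtain ⟨x, rfl⟩ := exists_blockIter_eq hK y
  set F := bgField (B1.aSeq a P.L K) (P.mesh K) (propagatorK C Finset.univ Abg msq a K) (avgQkAdj C Abg K) φ with hF
  set c : ℝ := B1.aSeq a P.L K * (P.mesh K ^ 2)⁻¹ with hc
  have hℓ : 0 < P.mesh K := P.mesh_pos K
  have hc0 : 0 < c := mul_pos hak (inv_pos.2 (pow_pos hℓ 2))
  have ht₁ : 0 ≤ t₁ := (norm_nonneg _).trans (h1 x)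
  -- `(G^ε_K)⁻¹ φ^{bg} = c • Q_K^* φ`
  have hcov : covOpK C Finset.univ Abg msq a K F = c • avgQkAdj C Abg K φ := by
    rw [hF, bgField, map_smul, hc]
    congr 1
    exact covOpK_propagatorK_apply C Finset.univ Abg hmsq a K hak.le _
  -- `(G^ε_K)⁻¹ = −Δ + m² + cP_K`, evaluated at `x`
  have hsplit : covOpK C Finset.univ Abg msq a K F x
      = covLaplacianN C Finset.univ Abg F x + msq • F x + c • projPk C Abg K F x := by
    have e : (P.mesh K)⁻¹ ^ 2 = (P.mesh K ^ 2)⁻¹ := by rw [inv_pow]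
    simp only [covOpK, LinearMap.add_apply, LinearMap.smul_apply, LinearMap.id_coe, id_eq, Pi.add_apply, Pi.smul_apply, e, hc]
  have hpt : c • avgQkAdj C Abg K φ x = covLaplacianN C Finset.univ Abg F x + msq • F x + c • projPk C Abg K F x := by
    rw [← hsplit, hcov, Pi.smul_apply]
  -- norms
  have hQ : ‖c • avgQkAdj C Abg K φ x‖ = c * ‖φ (blockIter K x)‖ := by
    rw [norm_smul, Real.norm_of_nonneg hc0.le, norm_avgQkAdj_apply]
  have hP : ‖projPk C Abg K F x‖ ≤ t₁ := norm_projPk_apply_le C Abg hK F h1 x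
  have hR : ‖covLaplacianN C Finset.univ Abg F x + msq • F x + c • projPk C Abg K F x‖ ≤ t₂ + msq * t₁ + c * t₁ := by
    refine (norm_add_le _ _).trans (add_le_add ((norm_add_le _ _).trans (add_le_add (h2 x) ?_)) ?_)
    · rw [norm_smul, Real.norm_of_nonneg hmsq.le]
      exact mul_le_mul_of_nonneg_left (h1 x) hmsq.le
    · rw [norm_smul, Real.norm_of_nonneg hc0.le]
      exact mul_le_mul_of_nonneg_left hP hc0.le
  have hmain : c * ‖φ (blockIter K x)‖ ≤ t₂ + msq * t₁ + c * t₁ := by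
    rw [← hQ, hpt]
    exact hR
  have hdiv : ‖φ (blockIter K x)‖ ≤ c⁻¹ * (t₂ + msq * t₁) + t₁ := by
    rw [← inv_mul_cancel_left₀ hc0.ne' ‖φ (blockIter K x)‖]
    calc c⁻¹ * (c * ‖φ (blockIter K x)‖) ≤ c⁻¹ * (t₂ + msq * t₁ + c * t₁) :=
          mul_le_mul_of_nonneg_left hmain (inv_nonneg.2 hc0.le)
      _ = c⁻¹ * (t₂ + msq * t₁) + t₁ := by rw [mul_add, inv_mul_cancel_left₀ hc0.ne']
  have hcinv : c⁻¹ = (B1.aSeq a P.L K)⁻¹ * P.mesh K ^ 2 := by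
    rw [hc, mul_inv, inv_inv]
  rwa [hcinv] at hdiv

end Mechanism

/-! ## §2 On the support of `χ_K(A)χ_K(φ)` the level-`K` fields are bounded -/

section Support

variable {N : ℕ} (C : ChargeData N) {K : ℕ} {mu0sq msq a : ℝ}

/-- A product of characteristic functions of the shape (3.27)/(3.28) is `0` or `1`; if it is `≠ 0`, every restriction holds.
[cite: Balaban1982Higgs1, (3.27)–(3.28) p.617] -/
theorem bounds_of_chiSmall_ne_zero {X : Type} [Fintype X] {d : ℕ} {ℓ p : ℝ} {absF absLap : X → ℝ}
    (h : chiSmall d ℓ p absF absLap ≠ 0) : ∀ x, absF x ≤ thrF d ℓ p ∧ absLap x ≤ thrLap d ℓ p := by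
  unfold chiSmall at h
  rw [chiProd_eq_ite] at h
  by_contra hx
  exact h (if_neg hx)

/-- **`χ_K(φ) ≠ 0 ⇒ |φ(y)| ≦ (a_K⁻¹(1 + m²ℓ²) + 1)·ℓ^{−(d−2)/2}p`** on `T^{(K)}` (`ℓ = L^Kε`; (3.28) restricts `φ^{(K),ε}` and `Δ^ε_{A^{(K),ε}}φ^{(K),ε}`,
the mechanism of (3.52) turns this into a bound of `φ` itself; `m² > 0`, `a_K > 0`, `K ≦ K_P`). [cite: Balaban1982Higgs1, (3.52) p.621; (3.28)–(3.29) p.617] -/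
theorem norm_le_of_chiKφ_ne_zero (hmsq : 0 < msq) (hK : K ≤ P.K) (hak : 0 < B1.aSeq a P.L K) {p : ℝ}
    {A : HiggsLattice.VecField P K} {φ : HiggsLattice.ScalarField P K N} (h : chiKφ C (P.mesh K) p mu0sq msq a K A φ ≠ 0) :
    ∀ y, ‖φ y‖ ≤ ((B1.aSeq a P.L K)⁻¹ * (1 + msq * P.mesh K ^ 2) + 1) * thrF P.d (P.mesh K) p := by
  have hb := bounds_of_chiSmall_ne_zero (h := h)
  have hℓ : 0 < P.mesh K := P.mesh_pos K
  have h1 : ∀ x, ‖bgField (B1.aSeq a P.L K) (P.mesh K) (propagatorK C Finset.univ (bgVec mu0sq a K A) msq a K)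
      (avgQkAdj C (bgVec mu0sq a K A) K) φ x‖ ≤ thrF P.d (P.mesh K) p := fun x => (hb x).1
  have h2 : ∀ x, ‖covLaplacianN C Finset.univ (bgVec mu0sq a K A) (bgField (B1.aSeq a P.L K) (P.mesh K)
      (propagatorK C Finset.univ (bgVec mu0sq a K A) msq a K) (avgQkAdj C (bgVec mu0sq a K A) K) φ) x‖
        ≤ (P.mesh K ^ 2)⁻¹ * thrF P.d (P.mesh K) p := fun x => by
    rw [← thrLap_eq_inv_sq_mul_thrF P.d hℓ p]
    exact (hb x).2
  intro y
  have hm := norm_le_of_bgField_bounds C (bgVec mu0sq a K A) hmsq hK hak φ h1 h2 y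
  have e : (B1.aSeq a P.L K)⁻¹ * P.mesh K ^ 2 * ((P.mesh K ^ 2)⁻¹ * thrF P.d (P.mesh K) p + msq * thrF P.d (P.mesh K) p)
      + thrF P.d (P.mesh K) p = ((B1.aSeq a P.L K)⁻¹ * (1 + msq * P.mesh K ^ 2) + 1) * thrF P.d (P.mesh K) p := by
    field_simp
  rw [← e]
  exact hm

/-- **`χ_K(A) ≠ 0 ⇒ |A(y)| ≦ (a_K⁻¹(1 + μ₀²ℓ²) + 1)·ℓ^{−(d−2)/2}p`** on `T^{(K)}` for the `ℝ^d`-valued site function `y ↦ (A_μ(y))_μ` (p. 608: the vector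
field is the case `N = d`, trivial coupling, external field `0`, mass `μ₀²`; (3.27) restricts `A^{(K),ε}` and `Δ^εA^{(K),ε}`).
[cite: Balaban1982Higgs1, (3.52) p.621; (3.27), (3.29) p.617] -/
theorem norm_toSite_le_of_chiKA_ne_zero (hmu : 0 < mu0sq) (hK : K ≤ P.K) (hak : 0 < B1.aSeq a P.L K) {p : ℝ}
    {A : HiggsLattice.VecField P K} (h : chiKA (P.mesh K) p mu0sq a K A ≠ 0) :
    ∀ y, ‖toSite A y‖ ≤ ((B1.aSeq a P.L K)⁻¹ * (1 + mu0sq * P.mesh K ^ 2) + 1) * thrF P.d (P.mesh K) p := by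
  have hb := bounds_of_chiSmall_ne_zero (h := h)
  have hℓ : 0 < P.mesh K := P.mesh_pos K
  have hv : toSite (bgVec (P := P) mu0sq a K A)
      = bgField (B1.aSeq a P.L K) (P.mesh K) (propagatorK (zeroCharge P.d) Finset.univ (0 : HiggsLattice.VecField P 0) mu0sq a K)
          (avgQkAdj (zeroCharge P.d) (0 : HiggsLattice.VecField P 0) K) (toSite A) := by
    rw [toSite_bgVec]
    rfl
  have h1 : ∀ x, ‖bgField (B1.aSeq a P.L K) (P.mesh K) (propagatorK (zeroCharge P.d) Finset.univ (0 : HiggsLattice.VecField P 0) mu0sq a K)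
      (avgQkAdj (zeroCharge P.d) (0 : HiggsLattice.VecField P 0) K) (toSite A) x‖ ≤ thrF P.d (P.mesh K) p := fun x => by
    rw [← hv]
    exact (hb x).1
  have h2 : ∀ x, ‖covLaplacianN (zeroCharge P.d) Finset.univ (0 : HiggsLattice.VecField P 0)
      (bgField (B1.aSeq a P.L K) (P.mesh K) (propagatorK (zeroCharge P.d) Finset.univ (0 : HiggsLattice.VecField P 0) mu0sq a K)
        (avgQkAdj (zeroCharge P.d) (0 : HiggsLattice.VecField P 0) K) (toSite A)) x‖ ≤ (P.mesh K ^ 2)⁻¹ * thrF P.d (P.mesh K) p := by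
    intro x
    rw [← hv, ← thrLap_eq_inv_sq_mul_thrF P.d hℓ p]
    exact (hb x).2
  intro y
  have hm := norm_le_of_bgField_bounds (zeroCharge P.d) (0 : HiggsLattice.VecField P 0) hmu hK hak (toSite A) h1 h2 y
  have e : (B1.aSeq a P.L K)⁻¹ * P.mesh K ^ 2 * ((P.mesh K ^ 2)⁻¹ * thrF P.d (P.mesh K) p + mu0sq * thrF P.d (P.mesh K) p)
      + thrF P.d (P.mesh K) p = ((B1.aSeq a P.L K)⁻¹ * (1 + mu0sq * P.mesh K ^ 2) + 1) * thrF P.d (P.mesh K) p := by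
    field_simp
  rw [← e]
  exact hm

/-- **ON THE SUPPORT OF `χ_K(A)χ_K(φ)` BOTH LEVEL-`K` FIELDS ARE BOUNDED** (`K ≧ 1`, cut-off weight `B1Ineq326HiggsModel.chiW` with thresholds
`ℓ_K = L^Kε`, `p_K`): `χ_K(A)χ_K(φ) ≠ 0 ⇒ |A(y)| ≦ (a_K⁻¹(1 + μ₀²ℓ²) + 1)ℓ^{−(d−2)/2}p_K`, `|φ(y)| ≦ (a_K⁻¹(1 + m²ℓ²) + 1)ℓ^{−(d−2)/2}p_K` — *"the
restrictions on the fields A, φ"* of p. 625. [cite: Balaban1982Higgs1, (3.52) p.621; p.625 (after (3.66)); (3.27)–(3.29) p.617] -/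
theorem field_bounds_of_chiW_ne_zero (ℓ p : ℕ → ℝ) (hK1 : 1 ≤ K) (hK : K ≤ P.K) (hmu : 0 < mu0sq) (hmsq : 0 < msq)
    (hak : 0 < B1.aSeq a P.L K) (hℓK : ℓ K = P.mesh K) {A : HiggsLattice.VecField P K} {φ : HiggsLattice.ScalarField P K N}
    (h : chiW C ℓ p mu0sq msq a K A φ ≠ 0) :
    (∀ y, ‖toSite A y‖ ≤ ((B1.aSeq a P.L K)⁻¹ * (1 + mu0sq * P.mesh K ^ 2) + 1) * thrF P.d (P.mesh K) (p K)) ∧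
      ∀ y, ‖φ y‖ ≤ ((B1.aSeq a P.L K)⁻¹ * (1 + msq * P.mesh K ^ 2) + 1) * thrF P.d (P.mesh K) (p K) := by
  obtain ⟨K', rfl⟩ : ∃ K', K = K' + 1 := ⟨K - 1, by omega⟩
  have h' : chiKA (ℓ (K' + 1)) (p (K' + 1)) mu0sq a (K' + 1) A
      * chiKφ C (ℓ (K' + 1)) (p (K' + 1)) mu0sq msq a (K' + 1) A φ ≠ 0 := h
  rw [hℓK] at h'
  exact ⟨norm_toSite_le_of_chiKA_ne_zero hmu hK hak (left_ne_zero_of_mul h'),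
    norm_le_of_chiKφ_ne_zero C hmsq hK hak (right_ne_zero_of_mul h')⟩

end Support

/-! ## §3 *"for some c independent of k, ε"*: the uniform constants and the unit-lattice reading -/

section Uniform

variable {N : ℕ} (C : ChargeData N) {K : ℕ} {mu0sq msq a : ℝ}

/-- **The constant is uniform**: for `a > 0`, `L > 1`, `K ≧ 1`, `ℓ = L^Kε ≦ 1` and a mass `m² ≧ 0`,
`a_K⁻¹(1 + m²ℓ²) + 1 ≦ (a(1 − L⁻²))⁻¹(1 + m²) + 1` (`a_K > a_∞ = a(1 − L⁻²)`, (2.15)) — *"for some c independent of k, ε"* (3.52).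
[cite: Balaban1982Higgs1, (3.52) p.621; (2.15) p.609] -/
theorem fieldConst_le (ha : 0 < a) (hL : 1 < (P.L : ℝ)) (hK1 : 1 ≤ K) {ms : ℝ} (hms : 0 ≤ ms) (hℓ1 : P.mesh K ≤ 1) :
    (B1.aSeq a P.L K)⁻¹ * (1 + ms * P.mesh K ^ 2) + 1 ≤ (a * (1 - ((P.L : ℝ) ^ 2)⁻¹))⁻¹ * (1 + ms) + 1 := by
  have hainf : 0 < a * (1 - ((P.L : ℝ) ^ 2)⁻¹) := by
    have : ((P.L : ℝ) ^ 2)⁻¹ < 1 := inv_lt_one_of_one_lt₀ (by nlinarith)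
    exact mul_pos ha (by linarith)
  have haK := B1.ainf_lt_aSeq ha hL K hK1
  have hinv : (B1.aSeq a P.L K)⁻¹ ≤ (a * (1 - ((P.L : ℝ) ^ 2)⁻¹))⁻¹ := (inv_le_inv₀ (hainf.trans haK) hainf).2 haK.le
  have hℓsq : P.mesh K ^ 2 ≤ 1 := pow_le_one₀ (P.mesh_pos K).le hℓ1
  have h1 : 1 + ms * P.mesh K ^ 2 ≤ 1 + ms := by nlinarith
  have h0 : 0 ≤ 1 + ms * P.mesh K ^ 2 := by positivity
  nlinarith [mul_le_mul hinv h1 h0 (inv_nonneg.2 hainf.le)]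

/-- **(3.52) at level `K` with `K, ε`-free constants**: on the support of `χ_K(A)χ_K(φ)` (`1 ≦ K ≦ K_P`, `L^Kε ≦ 1`, `a > 0`, `L > 1`, `m², μ₀² > 0`,
`p_K ≧ 0`): `|A(y)| ≦ c_A·(L^Kε)^{−(d−2)/2}p_K`, `|φ(y)| ≦ c_φ·(L^Kε)^{−(d−2)/2}p_K` with `c_A = (a(1−L⁻²))⁻¹(1 + μ₀²) + 1`, `c_φ = (a(1−L⁻²))⁻¹(1 + m²) + 1`.
[cite: Balaban1982Higgs1, (3.52) p.621; p.625 (after (3.66)); (2.15) p.609] -/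
theorem field_bounds_of_chiW_ne_zero_unif (ℓ p : ℕ → ℝ) (hK1 : 1 ≤ K) (hK : K ≤ P.K) (ha : 0 < a) (hL : 1 < (P.L : ℝ))
    (hmu : 0 < mu0sq) (hmsq : 0 < msq) (hℓK : ℓ K = P.mesh K) (hℓ1 : P.mesh K ≤ 1) (hp : 0 ≤ p K)
    {A : HiggsLattice.VecField P K} {φ : HiggsLattice.ScalarField P K N} (h : chiW C ℓ p mu0sq msq a K A φ ≠ 0) :
    (∀ y, ‖toSite A y‖ ≤ ((a * (1 - ((P.L : ℝ) ^ 2)⁻¹))⁻¹ * (1 + mu0sq) + 1) * thrF P.d (P.mesh K) (p K)) ∧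
      ∀ y, ‖φ y‖ ≤ ((a * (1 - ((P.L : ℝ) ^ 2)⁻¹))⁻¹ * (1 + msq) + 1) * thrF P.d (P.mesh K) (p K) := by
  have hak : 0 < B1.aSeq a P.L K := B1.aSeq_pos ha hL hK1
  obtain ⟨hA, hφ⟩ := field_bounds_of_chiW_ne_zero C ℓ p hK1 hK hmu hmsq hak hℓK h
  have hthr : 0 ≤ thrF P.d (P.mesh K) (p K) := mul_nonneg (Real.rpow_nonneg (P.mesh_pos K).le _) hp
  exact ⟨fun y => (hA y).trans (mul_le_mul_of_nonneg_right (fieldConst_le ha hL hK1 hmu.le hℓ1) hthr),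
    fun y => (hφ y).trans (mul_le_mul_of_nonneg_right (fieldConst_le ha hL hK1 hmsq.le hℓ1) hthr)⟩

/-- The unit-lattice reading of the threshold: `ℓ^{(d−2)/2}·(ℓ^{−(d−2)/2}p) = p` (`ℓ > 0`) — in the variables `φ′ = ℓ^{(d−2)/2}φ`, `A′ = ℓ^{(d−2)/2}A` of
the unit lattice `T₁^{(K)}` ((3.38) p. 618, (1.22)–(1.23) p. 607) the restriction (3.27)/(3.28) reads `|·| ≦ p`. [cite: Balaban1982Higgs1, (3.52) p.621; (3.38) p.618] -/
theorem rpow_mul_thrF (d : ℕ) {ℓ : ℝ} (hℓ : 0 < ℓ) (p : ℝ) : ℓ ^ (((d : ℝ) - 2) / 2) * thrF d ℓ p = p := by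
  unfold thrF
  rw [← mul_assoc, Real.rpow_neg hℓ.le, mul_inv_cancel₀ (Real.rpow_pos_of_pos hℓ _).ne', one_mul]

/-- **The arguments of (3.57) are bounded on the support of `χ_K`**: componentwise, in the unit-lattice variables `φ′_j(y) = ℓ^{(d−2)/2}φ_j(y)`,
`A′_μ(y) = ℓ^{(d−2)/2}A_μ(y)` (`ℓ = L^Kε ≦ 1`), `|φ′_j(y)| ≦ c_φ·p_K` and `|A′_μ(y)| ≦ c_A·p_K` whenever `χ_K(A)χ_K(φ) ≠ 0` — *"the restrictions on
the fields A, φ"* as used on p. 625 (a component is at most the Euclidean norm). [cite: Balaban1982Higgs1, p.625 (after (3.66)); (3.52) p.621] -/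
theorem unit_field_bounds_of_chiW_ne_zero (ℓ p : ℕ → ℝ) (hK1 : 1 ≤ K) (hK : K ≤ P.K) (ha : 0 < a) (hL : 1 < (P.L : ℝ))
    (hmu : 0 < mu0sq) (hmsq : 0 < msq) (hℓK : ℓ K = P.mesh K) (hℓ1 : P.mesh K ≤ 1) (hp : 0 ≤ p K)
    {A : HiggsLattice.VecField P K} {φ : HiggsLattice.ScalarField P K N} (h : chiW C ℓ p mu0sq msq a K A φ ≠ 0) :
    (∀ (y : HiggsLattice.Site P K) (μ : Fin P.d),
        |P.mesh K ^ (((P.d : ℝ) - 2) / 2) * A ⟨y, μ⟩| ≤ ((a * (1 - ((P.L : ℝ) ^ 2)⁻¹))⁻¹ * (1 + mu0sq) + 1) * p K) ∧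
      ∀ (y : HiggsLattice.Site P K) (j : Fin N),
        |P.mesh K ^ (((P.d : ℝ) - 2) / 2) * φ y j| ≤ ((a * (1 - ((P.L : ℝ) ^ 2)⁻¹))⁻¹ * (1 + msq) + 1) * p K := by
  obtain ⟨hA, hφ⟩ := field_bounds_of_chiW_ne_zero_unif C ℓ p hK1 hK ha hL hmu hmsq hℓK hℓ1 hp h
  have hs : 0 ≤ P.mesh K ^ (((P.d : ℝ) - 2) / 2) := Real.rpow_nonneg (P.mesh_pos K).le _
  have hscale : ∀ {c t : ℝ}, t ≤ c * thrF P.d (P.mesh K) (p K) → P.mesh K ^ (((P.d : ℝ) - 2) / 2) * t ≤ c * p K := by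
    intro c t ht
    calc P.mesh K ^ (((P.d : ℝ) - 2) / 2) * t ≤ P.mesh K ^ (((P.d : ℝ) - 2) / 2) * (c * thrF P.d (P.mesh K) (p K)) :=
          mul_le_mul_of_nonneg_left ht hs
      _ = c * (P.mesh K ^ (((P.d : ℝ) - 2) / 2) * thrF P.d (P.mesh K) (p K)) := by ring
      _ = c * p K := by rw [rpow_mul_thrF P.d (P.mesh_pos K)]
  refine ⟨fun y μ => ?_, fun y j => ?_⟩
  · rw [abs_mul, abs_of_nonneg hs]
    have hcomp : |A ⟨y, μ⟩| ≤ ‖toSite A y‖ := by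
      have h1 := PiLp.norm_apply_le (toSite A y) μ
      rwa [Real.norm_eq_abs] at h1
    exact (mul_le_mul_of_nonneg_left hcomp hs).trans (hscale (hA y))
  · rw [abs_mul, abs_of_nonneg hs]
    have hcomp : |φ y j| ≤ ‖φ y‖ := by
      have h1 := PiLp.norm_apply_le (φ y) j
      rwa [Real.norm_eq_abs] at h1
    exact (mul_le_mul_of_nonneg_left hcomp hs).trans (hscale (hφ y))

end Uniform

end Literature.MathematicalPhysics.QuantumFieldTheory.Balaban1983to89.B1Ineq352LevelK
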